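import Summits.ValiantsHypothesis.ValiantsHypothesis.Theses.TwoAdicLadder
import Literature.Computability.AlgebraicComplexity.RazElusiveGeneralRouteProofs

/-!
# Birth skeleton — crux `TwoIntegralNormalisation` (item `stmt-ValiantsHypothesis-5947`), line `birth`

Route `route-ValiantsHypothesis-TwoAdicLadder`, crux
`Summit.ValiantsHypothesis.ValiantsHypothesis.Theses.TwoAdicLadder.TwoIntegralNormalisation`
(card C1, finite-precision form: if the permanent family is p-computable over `ℂ` then with ONE
exponent `a`, for all large `n` and EVERY precision `k`, `per_n` has circuits of size `≤ n^a` over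
some finite commutative principal ideal ring `R` with `2` nilpotent and `2^k ≠ 0`).

The cut is the crux docstring's own three-step proof shape ("constants algebraic, then 2-ADICALLY
INTEGRAL at one prime 𝔭 ∣ 2 of the number field K_n at polynomial cost (the crux: eliminate
division by 2), then reduce O_{K_n,𝔭} → O/𝔭^m") = the route header's foreseen split
`TwoIntegralNormalisation ⇐ AlgConst → HalfElim`, with the reduction step made a separate named
lemma and the transport of circuits along ring homomorphisms (tree
`ArithCircuit.complexity_map_le`, `map_perPoly`) plus the exponent bookkeeping proved here:

* `stub_algConst` (ALGEBRAIC CONSTANTS IN A NUMBER FIELD; M, provable now) — if `per` is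
  p-computable over `ℂ` then for every `n` some number field `K_n` has
  `L_{K_n}(per_n) ≤ n^a + a` with one exponent `a`: the minimal `ℂ`-circuit is defined over the
  finitely generated `ℚ`-subalgebra `B ⊂ ℂ` of its constants (it computes `per_n` over `B` since
  `B → ℂ` is injective on coefficients), and `B ↠ B/𝔪 = K_n` is a number field by Zariski's lemma;
  map the circuit along it (Bürgisser 2000 §4.1; tree `ArithCircuit.map`, `BurgisserBooleanPartsA3Steps.skeleton`).
* `stub_halfElim` (THE 1/2-ELIMINATION, hypothesis-free and uniform; open — the load-bearing stub)
  — one exponent `d` such that for all `n, s` and every number field `K`: `L_K(per_n) ≤ s`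
  implies `L_{O_(𝔭)}(per_n) ≤ (s + n + 2)^d` for some number field `K'` and some prime `𝔭 ∋ 2`
  of `𝓞 K'`, circuits over the local ring `Localization.AtPrime 𝔭` (= `𝔭`-integral constants).
  This is the refuter-recommended HalfElim form (item note rreview b500b1b3: "the hypothesis-free
  content is HalfElim; provers should work on HalfElim-type statements, not on TIN directly").
* `stub_chainRingReduction` (FINITE CHAIN-RING QUOTIENTS OF EVERY 2-ADIC LENGTH; M, provable now)
  — for a number field `K` and a prime `𝔭 ∋ 2` of `𝓞 K`, for every `k` the DVR
  `Localization.AtPrime 𝔭` maps to a finite principal ideal ring `R` with `2` nilpotent and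
  `2^k ≠ 0` (`R = O_(𝔭)/𝔭^(e k + 1)`, `e` the ramification index: finite as `𝓞 K/𝔭^m`, principal
  as a quotient of a PID, `2 = u π^e`).
* `TwoIntegralNormalisation_of` — the composition, kernel-checked and sorry-free: at `n ≥ 2`
  (`Filter.eventually_ge_atTop`) chain the three, transport the `O_(𝔭)`-circuit to `R` along the
  reduction map (`complexity_map_le` + `map_perPoly`: extension of scalars is free) and certify
  `(n^a + a + n + 2)^d ≤ n^((a+3)d)` (`envelope_bound`).

Disproof used: none exists for this crux at registration (`ledger crux ls stmt-ValiantsHypothesis-5947`: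
no workfiles, no `Disproof.lean`, no `_false_without_` theorem, no landed Negative lemma; the
negatives index of the summit (4 entries: UlrichPadded, Elusive, GrenetRigidity ×2) has nothing on
constants / 2-adic reduction). Refuter route-review (b500b1b3) is honoured: TIN itself is
`PrecisionLadder → VH` in disguise, so NO stub mentions `IsPComputable … ℂ` except `stub_algConst`,
whose conclusion (number-field circuits) is a classical normalisation, and the open content sits in
the hypothesis-free `stub_halfElim`.

BC3 record (registrar session planner-skel-stmt-ValiantsHypothesis-5947-0, 2026-08-17): `lean check`
rc 0, sorries = 3 = stubs (zero elsewhere; `TwoIntegralNormalisation_of` axioms `propext`,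
`Classical.choice`, `Quot.sound`); probes `stub → TwoIntegralNormalisation` and
`stub → ValiantsHypothesis` by `first | exact? | simpa | aesop` at `maxHeartbeats 400000`: 6/6 FAIL
(unsolved goals after exhaustive aesop search); unfolding variants `simpa [defs]`,
`(unfold; simpa)`, `(unfold; aesop)`: 6/6 FAIL (exhaustive-search failures, one whnf heartbeat
timeout); converses `TwoIntegralNormalisation → stub`, `ValiantsHypothesis → stub`: 6/6 fail
(info). No stub is cheaply the crux or the summit.
-/

set_option linter.dupNamespace false

namespace Summit.ValiantsHypothesis.ValiantsHypothesis.Cruxes.TwoIntegralNormalisation.Birth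

open Summit.ValiantsHypothesis.ValiantsHypothesis.Theses.TwoAdicLadder
open Literature.Computability.AlgebraicComplexity

/-- **AlgConst — ALGEBRAIC CONSTANTS: `VP`-CIRCUITS FOR `per` OVER NUMBER FIELDS** (stub statement,
named). If the permanent family is p-computable over `ℂ`, then there is one exponent `a` such that
for every `n` some number field `K` (depending on `n`) has `L_K(per_n) ≤ n^a + a`.
[Burgisser2000 §4.1 (the hypothesis `VP = VNP` and complexity of integer polynomials do not depend
on the algebraically closed field of a given characteristic; constants may be taken algebraic);
proof route: restrict the minimal circuit to the finitely generated `ℚ`-subalgebra `B ⊂ ℂ` of its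
constants, then map along `B ↠ B/𝔪`, a number field by Zariski's lemma (Mathlib
`Algebra.FiniteType`, `Ideal.exists_maximal`, `Module.Finite` of the residue field); tree
`ArithCircuit.map`, `map_perPoly`, `MvPolynomial.map_injective`] -/
def AlgConst : Prop :=
  IsPComputable (fun n => perPoly (Fin n) ℂ) →
    ∃ a : ℕ, ∀ n : ℕ, ∃ (K : Type) (_ : Field K) (_ : NumberField K),
      complexity (perPoly (Fin n) K) ≤ n ^ a + a

/-- **HalfElim — ELIMINATION OF DIVISION BY TWO AT POLYNOMIAL COST** (stub statement, named; the
load-bearing, OPEN stub). There is one exponent `d` such that for all `n s` and every number field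
`K`: if `L_K(per_n) ≤ s` then for some number field `K'` and some prime ideal `𝔭` of `𝓞 K'`
containing `2`, the permanent `per_n` has circuits of size `≤ (s + n + 2)^d` whose constants lie in
the local ring `O_(𝔭) = Localization.AtPrime 𝔭` (i.e. are `𝔭`-adically integral).
[open; Burgisser2000 Ch. 4 §4.3 (reduction of algebraic constants modulo p needs p-integrality),
Koiran2004 Thm 4.3 = tree `Burgisser2009_thm210` (integral completeness of `per` only up to
`2^p(n)`), arXiv:2601.00387 §2.1 p.7 ("divisions by two occur"); route header TWO-LAYER PLAN
`HalfElim`] -/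
def HalfElim : Prop :=
  ∃ d : ℕ, ∀ (n s : ℕ) (K : Type) [Field K] [NumberField K],
    complexity (perPoly (Fin n) K) ≤ s →
      ∃ (K' : Type) (_ : Field K') (_ : NumberField K')
        (P : Ideal (NumberField.RingOfIntegers K')) (_ : P.IsPrime),
        (2 : NumberField.RingOfIntegers K') ∈ P ∧
        complexity (perPoly (Fin n) (Localization.AtPrime P)) ≤ (s + n + 2) ^ d

/-- **ChainRingReduction — THE LOCAL RING AT A PRIME OVER 2 REDUCES ONTO ADMISSIBLE RINGS OF EVERY
PRECISION** (stub statement, named). For a number field `K` and a prime ideal `𝔭` of `𝓞 K` with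
`2 ∈ 𝔭`, and every `k`, there is a finite commutative principal ideal ring `R` with `2` nilpotent,
`2^k ≠ 0` and a ring homomorphism `Localization.AtPrime 𝔭 →+* R` (namely
`R = O_(𝔭) ⧸ 𝔭^(e·k+1) ≅ 𝓞 K ⧸ 𝔭^(e·k+1)`, `e = v_𝔭(2) ≥ 1`). [folklore algebraic number theory:
Mathlib `IsDedekindDomain`, `IsLocalization.AtPrime.isDiscreteValuationRing_of_dedekind_domain`,
`IsPrincipalIdealRing.of_surjective`, `Ideal.fintypeQuotientOfFreeOfNeBot`; Neukirch I §3, I §8] -/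
def ChainRingReduction : Prop :=
  ∀ (K : Type) [Field K] [NumberField K] (P : Ideal (NumberField.RingOfIntegers K)) [P.IsPrime],
    (2 : NumberField.RingOfIntegers K) ∈ P → ∀ k : ℕ,
      ∃ (R : Type) (_ : CommRing R) (_ : Fintype R),
        IsPrincipalIdealRing R ∧ IsNilpotent (2 : R) ∧ (2 : R) ^ k ≠ 0 ∧
        Nonempty (Localization.AtPrime P →+* R)

/-- Stub AlgConst (registered obligation; signature = `AlgConst` verbatim). [Burgisser2000 §4.1] -/
theorem stub_algConst :
    IsPComputable (fun n => perPoly (Fin n) ℂ) →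
      ∃ a : ℕ, ∀ n : ℕ, ∃ (K : Type) (_ : Field K) (_ : NumberField K),
        complexity (perPoly (Fin n) K) ≤ n ^ a + a := by
  sorry

/-- Stub HalfElim (registered obligation; signature = `HalfElim` verbatim). [open;
Burgisser2000 §4.3, Koiran2004 Thm 4.3, arXiv:2601.00387 §2.1] -/
theorem stub_halfElim :
    ∃ d : ℕ, ∀ (n s : ℕ) (K : Type) [Field K] [NumberField K],
      complexity (perPoly (Fin n) K) ≤ s →
        ∃ (K' : Type) (_ : Field K') (_ : NumberField K')
          (P : Ideal (NumberField.RingOfIntegers K')) (_ : P.IsPrime),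
          (2 : NumberField.RingOfIntegers K') ∈ P ∧
          complexity (perPoly (Fin n) (Localization.AtPrime P)) ≤ (s + n + 2) ^ d := by
  sorry

/-- Stub ChainRingReduction (registered obligation; signature = `ChainRingReduction` verbatim).
[folklore; Mathlib `IsPrincipalIdealRing.of_surjective`, `Ideal.fintypeQuotientOfFreeOfNeBot`] -/
theorem stub_chainRingReduction :
    ∀ (K : Type) [Field K] [NumberField K] (P : Ideal (NumberField.RingOfIntegers K)) [P.IsPrime],
      (2 : NumberField.RingOfIntegers K) ∈ P → ∀ k : ℕ,
        ∃ (R : Type) (_ : CommRing R) (_ : Fintype R),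
          IsPrincipalIdealRing R ∧ IsNilpotent (2 : R) ∧ (2 : R) ^ k ≠ 0 ∧
          Nonempty (Localization.AtPrime P →+* R) := by
  sorry

/-! ## Name-keyed aliases of the stub statements (hypotheses of the composition)

`Registered.stub_X` is the statement of `stub_X` under the registered stub's short name, so that the
native skeleton audit (hypotheses admissible iff registered obligations / declared stubs BY NAME)
accepts `TwoIntegralNormalisation_of : Registered.stub_… → … → TwoIntegralNormalisation`
(device of `Cruxes/TameTransfer/Lines/birth.lean`, `Cruxes/RestorationQP/Lines/birth.lean`). -/
namespace Registered

/-- Alias of `AlgConst` (= the signature of `stub_algConst`). -/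
abbrev stub_algConst : Prop := AlgConst
/-- Alias of `HalfElim` (= the signature of `stub_halfElim`). -/
abbrev stub_halfElim : Prop := HalfElim
/-- Alias of `ChainRingReduction` (= the signature of `stub_chainRingReduction`). -/
abbrev stub_chainRingReduction : Prop := ChainRingReduction

end Registered

/-- Envelope bookkeeping of the composition: for `n ≥ 2`, `n^a + a + n + 2 ≤ n^(a+3)`. [folklore] -/
theorem envelope_bound (a n : ℕ) (hn : 2 ≤ n) : n ^ a + a + n + 2 ≤ n ^ (a + 3) := by
  have h1 : a ≤ n ^ a := (a.lt_two_pow_self).le.trans (Nat.pow_le_pow_left hn a)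
  have h2 : 1 ≤ n ^ a := Nat.one_le_pow _ _ (by omega)
  have h3 : n + 4 ≤ n ^ 3 := by
    have h : 2 * 2 * n ≤ n * n * n := Nat.mul_le_mul (Nat.mul_le_mul hn hn) le_rfl
    calc n + 4 ≤ 2 * 2 * n := by omega
      _ ≤ n * n * n := h
      _ = n ^ 3 := by ring
  have h4 : n + 2 ≤ (n + 2) * n ^ a := by
    simpa using Nat.mul_le_mul_left (n + 2) h2
  calc n ^ a + a + n + 2 ≤ n ^ a + n ^ a + (n + 2) * n ^ a := by omega
    _ = (n + 4) * n ^ a := by ring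
    _ ≤ n ^ 3 * n ^ a := Nat.mul_le_mul_right _ h3
    _ = n ^ (a + 3) := by ring

/-- **Composition** (the glue of the line, kernel-checked): number-field circuits (`stub_algConst`)
→ `𝔭`-integral circuits of size `(n^a + a + n + 2)^d` (`stub_halfElim`) → transport along
`O_(𝔭) → R` to an admissible ring of precision `k` (`stub_chainRingReduction`, extension of scalars
is free: `ArithCircuit.complexity_map_le`, `map_perPoly`) → envelope `≤ n^((a+3)d)` for `n ≥ 2`.
[folklore] -/
theorem TwoIntegralNormalisation_of :
    Registered.stub_algConst → Registered.stub_halfElim → Registered.stub_chainRingReduction →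
      TwoIntegralNormalisation := by
  intro h₁ h₂ h₃ hP
  obtain ⟨a, ha⟩ := h₁ hP
  obtain ⟨d, hd⟩ := h₂
  refine ⟨(a + 3) * d, ?_⟩
  filter_upwards [Filter.eventually_ge_atTop 2] with n hn
  intro k
  obtain ⟨K, _, _, hK⟩ := ha n
  obtain ⟨K', _, _, P, _, h2P, hle⟩ := hd n (n ^ a + a) K hK
  obtain ⟨R, _, _, hPIR, hnil, hne, ⟨φ⟩⟩ := h₃ K' P h2P k
  refine ⟨R, ‹CommRing R›, ‹Fintype R›, hPIR, hnil, hne, ?_⟩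
  have hmap := ArithCircuit.complexity_map_le φ (perPoly (Fin n) (Localization.AtPrime P))
  rw [map_perPoly] at hmap
  calc complexity (perPoly (Fin n) R)
        ≤ complexity (perPoly (Fin n) (Localization.AtPrime P)) := hmap
    _ ≤ (n ^ a + a + n + 2) ^ d := hle
    _ ≤ (n ^ (a + 3)) ^ d := Nat.pow_le_pow_left (envelope_bound a n hn) d
    _ = n ^ ((a + 3) * d) := (pow_mul n (a + 3) d).symm

/-- Wiring check: the registered stubs feed `TwoIntegralNormalisation_of` exactly as stated, so the
skeleton is `TwoIntegralNormalisation` closed modulo the three stubs (sorries enter only through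
them). -/
example : TwoIntegralNormalisation :=
  TwoIntegralNormalisation_of stub_algConst stub_halfElim stub_chainRingReduction

end Summit.ValiantsHypothesis.ValiantsHypothesis.Cruxes.TwoIntegralNormalisation.Birth
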